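import Mathlib
import Summits.ValiantsHypothesis.ValiantsHypothesis.Theorems.BarrierLeverPartitionMinorsHitByVPHiddenStatesSymbolic

/-!
# Route BarrierLever — item `PartitionMinorsHitByVP` (stmt-ValiantsHypothesis-19717), line `hidden-states`:
# THE FREE-PARTS LEMMA — affinely independent member families are generically free points

Helper file (`--supports stmt-ValiantsHypothesis-19717`; cell valiant-natproofs, rung V4, 𝒟-side door (c), registered line
`Cruxes/PartitionMinorsHitByVP/Lines/hidden_states.lean` v2, lane `stub_universalJoinWide`; prover seat val-np-p6 gen 8).
No definitions. Closes NO item.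

THE POINT. In the symbolic language of `…HiddenStatesSymbolic` (val-np-p3 g10) a join configuration `e : Fin r → Fin m × Finset (Fin K)`
is GENERICALLY GOOD for the rows `u` when `symDet u e ≠ 0`; the fitting certificates (`Fit`, `symGood_of_split`) recurse along hyperplane
cuts down to the leaf case `symGood_of_lonely` (every column alone in its piece). This file proves the natural STRONGER leaf case of the
cut-tree game (memo val-np-p6 g8 «cut-tree certifiability», D2): if inside every piece the affine row vectors `(1, 1_J)` of its members
are linearly independent — i.e. each piece's member family is AFFINELY INDEPENDENT as a set of 0/1 points — then the configuration is
generically good for EVERY injective row family `u` (`symGood_of_affFree`). Reason: an affine map is freely prescribed on an affinely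
independent set, so some table puts the hidden point of column `k` exactly at the indicator vector of `u k` (`exists_table_eq_indicator`,
linear algebra: a matrix with linearly independent rows has surjective `mulVec`, `exists_solution_of_linearIndependent`), and the resulting
zeta matrix `[u i ⊆ u k]` is nonsingular (`TwoLayer.eq_zero_of_zeta`). Stars and every family whose members (all but one) own a private state
(`affFree_of_private`, a decidable sufficient condition) are affinely free; `symGood_of_lonely` is the special case of one column per piece.
Consequence for certificate search: a cut tree may stop as soon as every piece's part is affinely independent (the solver of val-np-p6 g8
does exactly this), and the combinatorial content of the conjecture node becomes «shatter every piece into affinely independent parts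
consistently with the trie of u».

WHAT THIS IS NOT: no bearing on which designs are universal; item 19717 OPEN; nothing on crux 14610 or VP ≠ VNP.
-/

set_option linter.dupNamespace false

namespace Summit.ValiantsHypothesis.ValiantsHypothesis.Theorems.BarrierLever.HiddenStates

open Finset Matrix MvPolynomial

noncomputable section

namespace SymbJoin

variable {h m K r : ℕ}

/-! ## 1. Conventions

The AFFINE ROW VECTOR of column `k` (`(p, J) = e k`) is `(1, 1_J)`, written as the function on `Option (Fin K)` with `none ↦ 1`,
`some q ↦ [q ∈ J]`; piece `p` is AFFINELY FREE when the affine row vectors of its columns are linearly independent over `ℂ`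
(equivalently the 0/1 points `1_J` of its members are affinely independent). The hypothesis is spelled out verbatim below. -/

/-! ## 2. Linear algebra: independent rows ⇒ every right-hand side is solvable -/

/-- A matrix with linearly independent rows has surjective `mulVec`: every system `Σ_j v i j · w j = c i` is solvable. -/
theorem exists_solution_of_linearIndependent {ι κ : Type*} [Fintype ι] [Fintype κ] [DecidableEq ι] [DecidableEq κ]
    (v : ι → κ → ℂ) (hv : LinearIndependent ℂ v) (c : ι → ℂ) :
    ∃ w : κ → ℂ, ∀ i, ∑ j, v i j * w j = c i := by
  classical
  let A : Matrix ι κ ℂ := Matrix.of v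
  have hrow : LinearIndependent ℂ A.row := by
    have : A.row = v := by
      funext i j; rfl
    rw [this]; exact hv
  have hrank : A.rank = Fintype.card ι := hrow.rank_matrix
  have htop : LinearMap.range A.mulVecLin = ⊤ := by
    apply Submodule.eq_top_of_finrank_eq
    rw [Module.finrank_fintype_fun_eq_card]
    exact hrank
  have hsurj : Function.Surjective A.mulVecLin := LinearMap.range_eq_top.mp htop
  obtain ⟨w, hw⟩ := hsurj c
  refine ⟨w, fun i => ?_⟩
  have := congrFun hw i
  rw [Matrix.mulVecLin_apply, Matrix.mulVec, dotProduct] at this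
  simpa [A] using this

/-! ## 3. The table: hidden points at prescribed positions -/

/-- If every piece is affinely free, the hidden points can be placed anywhere: for every target `c k : Fin h → ℂ` there is a table
with `tx p none a + Σ_{q ∈ J} tx p (some q) a = c k a` for every column `k`, `(p, J) = e k`. -/
theorem exists_table_eq_target (e : Fin r → Fin m × Finset (Fin K)) (hfree : ∀ p, LinearIndependent ℂ fun k : {k : Fin r // (e k).1 = p} =>
      (fun o : Option (Fin K) => Option.elim o (1 : ℂ) fun q => if q ∈ (e k.1).2 then 1 else 0)) (c : Fin r → Fin h → ℂ) :
    ∃ tx : Fin m → Option (Fin K) → Fin h → ℂ,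
      ∀ k a, tx (e k).1 none a + ∑ q ∈ (e k).2, tx (e k).1 (some q) a = c k a := by
  classical
  -- piece by piece and coordinate by coordinate
  have hsol : ∀ (p : Fin m) (a : Fin h), ∃ w : Option (Fin K) → ℂ,
      ∀ k : {k : Fin r // (e k).1 = p}, ∑ o, (Option.elim o (1 : ℂ) fun q => if q ∈ (e k.1).2 then 1 else 0) * w o = c k.1 a := by
    intro p a
    exact exists_solution_of_linearIndependent
      (fun k : {k : Fin r // (e k).1 = p} => fun o : Option (Fin K) => Option.elim o (1 : ℂ) fun q => if q ∈ (e k.1).2 then 1 else 0)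
      (hfree p) (fun k => c k.1 a)
  choose w hw using hsol
  refine ⟨fun p o a => w p a o, fun k a => ?_⟩
  have hk := hw (e k).1 a ⟨k, rfl⟩
  -- unfold the sum over `Option (Fin K)`
  rw [Fintype.sum_option] at hk
  simp only [Option.elim_none, one_mul, Option.elim_some, ite_mul, zero_mul] at hk
  rw [Finset.sum_ite_mem, Finset.univ_inter] at hk
  exact hk

/-- In particular the hidden point of column `k` can be the indicator vector of the row `u k`. -/
theorem exists_table_eq_indicator (e : Fin r → Fin m × Finset (Fin K)) (hfree : ∀ p, LinearIndependent ℂ fun k : {k : Fin r // (e k).1 = p} =>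
      (fun o : Option (Fin K) => Option.elim o (1 : ℂ) fun q => if q ∈ (e k.1).2 then 1 else 0))
    (u : Fin r → Finset (Fin h)) :
    ∃ tx : Fin m → Option (Fin K) → Fin h → ℂ,
      ∀ k a, tx (e k).1 none a + ∑ q ∈ (e k).2, tx (e k).1 (some q) a = if a ∈ u k then 1 else 0 :=
  exists_table_eq_target e hfree fun k a => if a ∈ u k then 1 else 0

/-! ## 4. The free-parts lemma -/

/-- **THE FREE-PARTS LEMMA.** If every piece of the configuration `e` is affinely free, then `e` is generically good for EVERY
injective row family `u`: `symDet u e ≠ 0`. (Zeta table: hidden point of column `k` = indicator of `u k`; the matrix is `[u i ⊆ u k]`.) -/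
theorem symGood_of_affFree (u : Fin r → Finset (Fin h)) (hu : Function.Injective u) (e : Fin r → Fin m × Finset (Fin K))
    (hfree : ∀ p, LinearIndependent ℂ fun k : {k : Fin r // (e k).1 = p} =>
      (fun o : Option (Fin K) => Option.elim o (1 : ℂ) fun q => if q ∈ (e k.1).2 then 1 else 0)) : symDet u e ≠ 0 := by
  classical
  obtain ⟨tx, hpt⟩ := exists_table_eq_indicator e hfree u
  refine symGood_of_table u e tx ?_
  have hentry : ∀ i k, ∏ a ∈ u i, (tx (e k).1 none a + ∑ q ∈ (e k).2, tx (e k).1 (some q) a)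
      = if u i ⊆ u k then 1 else 0 := by
    intro i k
    simp_rw [hpt k]
    rw [Finset.prod_boole]
    by_cases hsub : u i ⊆ u k
    · rw [if_pos hsub, if_pos (fun a ha => hsub ha)]
    · rw [if_neg hsub, if_neg (fun hall => hsub (fun a ha => hall a ha))]
  intro hdet
  obtain ⟨α, hαne, hαmul⟩ := Matrix.exists_mulVec_eq_zero_iff.mpr hdet
  apply hαne
  let col : Fin r → (Fin r → ℂ) := fun k i =>
    ∏ a ∈ u i, (tx (e k).1 none a + ∑ q ∈ (e k).2, tx (e k).1 (some q) a)
  have hzeta : ∀ k ∈ (Finset.univ : Finset (Fin r)), ∀ k' ∈ (Finset.univ : Finset (Fin r)),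
      col k' (id k) = if u k ⊆ u k' then 1 else 0 := fun k _ k' _ => hentry k k'
  have hsum : ∑ k, α k • col k = 0 := by
    funext i
    have := congrFun hαmul i
    rw [Matrix.mulVec, dotProduct] at this
    simp only [Matrix.of_apply, Pi.zero_apply] at this
    rw [Finset.sum_apply, Pi.zero_apply]
    simpa [col, Pi.smul_apply, smul_eq_mul, mul_comm] using this
  funext k
  exact TwoLayer.eq_zero_of_zeta u hu col Finset.univ id hzeta α (fun k hk => absurd (Finset.mem_univ k) hk) hsum k

/-- The numeric form: an affinely free configuration has, for every injective `u`, a table with nonsingular block-additive matrix. -/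
theorem exists_table_of_affFree (u : Fin r → Finset (Fin h)) (hu : Function.Injective u) (e : Fin r → Fin m × Finset (Fin K))
    (hfree : ∀ p, LinearIndependent ℂ fun k : {k : Fin r // (e k).1 = p} =>
      (fun o : Option (Fin K) => Option.elim o (1 : ℂ) fun q => if q ∈ (e k.1).2 then 1 else 0)) :
    ∃ tx : Fin m → Option (Fin K) → Fin h → ℂ,
      (Matrix.of fun i k : Fin r =>
        ∏ a ∈ u i, (tx (e k).1 none a + ∑ q ∈ (e k).2, tx (e k).1 (some q) a)).det ≠ 0 :=
  exists_table_of_symGood u e (symGood_of_affFree u hu e hfree)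

/-! ## 5. Sufficient conditions for affine freeness -/

/-- Lonely columns (at most one column per piece) are affinely free — so `symGood_of_lonely` is a special case of the free-parts lemma. -/
theorem affFree_of_lonely (e : Fin r → Fin m × Finset (Fin K)) (hl : Function.Injective fun k => (e k).1) (p : Fin m) :
    LinearIndependent ℂ fun k : {k : Fin r // (e k).1 = p} =>
      (fun o : Option (Fin K) => Option.elim o (1 : ℂ) fun q => if q ∈ (e k.1).2 then 1 else 0) := by
  classical
  haveI : Subsingleton {k : Fin r // (e k).1 = p} :=
    ⟨fun a b => Subtype.ext (hl (a.2.trans b.2.symm))⟩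
  refine (linearIndependent_subsingleton_index_iff _).mpr fun k => ?_
  intro hzero
  have := congrFun hzero none
  simp at this

/-- **Private states.** If all columns of piece `p` except possibly one (`k₀`) own a PRIVATE state — a state of their member set lying in
no other member of the piece — then piece `p` is affinely free. Covers stars (base `∅` + rays), sub-stars and every family of pairwise
"cornered" sets; a decidable test for certificate leaves. -/
theorem affFree_of_private (e : Fin r → Fin m × Finset (Fin K)) (p : Fin m) (k₀ : Fin r)
    (pv : Fin r → Fin K)
    (hmem : ∀ k, (e k).1 = p → k ≠ k₀ → pv k ∈ (e k).2)
    (hpriv : ∀ k k', (e k).1 = p → (e k').1 = p → k ≠ k₀ → k' ≠ k → pv k ∉ (e k').2) :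
    LinearIndependent ℂ fun k : {k : Fin r // (e k).1 = p} =>
      (fun o : Option (Fin K) => Option.elim o (1 : ℂ) fun q => if q ∈ (e k.1).2 then 1 else 0) := by
  classical
  rw [Fintype.linearIndependent_iff]
  intro g hg
  -- every column other than k₀ has coefficient zero: read the relation at its private state
  have hother : ∀ k : {k : Fin r // (e k).1 = p}, k.1 ≠ k₀ → g k = 0 := by
    intro k hk
    have hq := congrFun hg (some (pv k.1))
    rw [Finset.sum_apply, Pi.zero_apply] at hq
    simp only [Pi.smul_apply, Option.elim_some, smul_eq_mul, mul_ite, mul_one, mul_zero] at hq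
    rw [Finset.sum_eq_single k] at hq
    · simpa [hmem k.1 k.2 hk] using hq
    · intro k' _ hk'
      rw [if_neg]
      exact hpriv k.1 k'.1 k.2 k'.2 hk (fun h' => hk' (Subtype.ext h'))
    · intro h'; exact absurd (Finset.mem_univ k) h'
  -- then the `none` coordinate kills the last coefficient
  intro k
  by_cases hk : k.1 = k₀
  · have h0 := congrFun hg none
    rw [Finset.sum_apply, Pi.zero_apply] at h0
    simp only [Pi.smul_apply, Option.elim_none, smul_eq_mul, mul_one] at h0
    rw [Finset.sum_eq_single k] at h0
    · exact h0
    · intro k' _ hk'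
      exact hother k' (fun h' => hk' (Subtype.ext (h'.trans hk.symm)))
    · intro h'; exact absurd (Finset.mem_univ k) h'
  · exact hother k hk

/-- `symGood_of_lonely` recovered from the free-parts lemma. -/
theorem symGood_of_lonely' (u : Fin r → Finset (Fin h)) (hu : Function.Injective u) (e : Fin r → Fin m × Finset (Fin K))
    (hl : Function.Injective fun k => (e k).1) : symDet u e ≠ 0 :=
  symGood_of_affFree u hu e fun p => affFree_of_lonely e hl p

end SymbJoin

end

end Summit.ValiantsHypothesis.ValiantsHypothesis.Theorems.BarrierLever.HiddenStates
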